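import Literature.MathematicalPhysics.QuantumFieldTheory.Balaban1983to89.B4CubeOpReindex
import Literature.MathematicalPhysics.QuantumFieldTheory.Balaban1983to89.B4Ineq110LpChain
import Literature.MathematicalPhysics.QuantumFieldTheory.Balaban1983to89.B4Lemma22EtaBox

/-!
# `Balaban1983to89.B4LpNormTransfer` — [Balaban1983RegularityDecay] (2.20)/(2.21): «‖T‖_{q,p} denotes a norm of an
# operator T : L^p → L^q» — the DICTIONARY between the norms in which the Lemma-2.2 lineage states the per-cube factors
# (`B4Lemma22EtaBox.lpW` = `η`-weighted mixed `ℓ^p(ℓ²)`, `supN` = sup of Euclidean colour norms, on the cube's own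
# carrier) and the norms in which the general-`Ω` chain `B4Ineq110LpChain.ineq110_value_lp` consumes them
# (`lpv w p` = `w`-weighted entrywise `ℓ^p`, Mathlib's sup norm, on the region, after zero-padding `B4CubeOpReindex.pad`)

statement-level skeleton of published theorems with citation tags; proofs where landed; nothing here is a claim about the Yang–Mills mass gap

CITATION HEADER.  T. Bałaban, *Regularity and decay of lattice Green's functions*, Commun. Math. Phys. **89** (1983)
571–597, doi:10.1007/bf01214744 [Balaban1983RegularityDecay] (cell paper B4; held text
`paper:balaban1983-cmp89-regularity-decay`, journal page = PDF page + 570; pp. 577–579).  Unit `lit-balaban-r01` gen 7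
(B4 fold owner), HOME `run/shared/lean/pub/lit-balaban/`, SKELETON rows **B4.Eq2.18** ((2.20)/(2.21): the factor norms)
and **B4.Thm@573** (file 3a of the r01 g7 programme: the general-`Ω` Theorem (1.10) under `R₀`, end to end).  Imports
p17 g4's `B4CubeOpReindex` (`pad`, `pad_apply_img`, `pad_apply_of_left`), r01 g6's `B4Ineq110LpChain` (`lpv`) and the
lineage's `B4Lemma22EtaBox` (`vol`, `lpW`; → `B4Lemma22LpStair.lpS`/`lpM`, `B4Lemma22Reduce231.supN`/`siteNorm`).

WHAT IS PRINTED (pp. 578–579, verbatim).  «(2.17) ‖G_k(□,Ã)f‖_q, … ≤ c₂‖f‖_p for 1 ≤ p, q ≤ ∞ … Here ‖·‖_q, ‖·‖_p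
denote the usual L_q and L_p norms»; «(2.21) … ‖K_{ω₁}G_k(□_{ω₁},Ã_{ω₁})h_{ω₁}‖_{∞,p₁}‖K_{ω₂}…h_{ω₂}‖_{p₁,p₁/2} ⋯
Π_{i=n₀+1}^{n}‖K_{ω_i}G_k(□_{ω_i},Ã_{ω_i})h_{ω_i}‖_{2,2}‖f‖₂»; «Here ‖T‖_{q,p} denotes a norm of an operator T : L^p → L^q».

WHAT THIS MODULE PROVES (all in full; finite site sets `X ⊇ e(X′)`, colours `ι`, `N = card ι`).
* §1 VECTORS ALONG AN INJECTION `e : X′ ↪ X` (the cube's sites inside the region): `pad_mulVec_apply_img` /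
  `pad_mulVec_apply_off` (`pad_e(B)g` is `B(g∘e)` on the image and `0` off it), `norm_pad_mulVec`
  (`‖pad_e(B)g‖_∞ = ‖B(g∘e)‖_∞`), `norm_res_le` (`‖g∘e‖_∞ ≤ ‖g‖_∞`), `lpv_pad_mulVec` (`‖pad_e(B)g‖_{p,w} =
  ‖B(g∘e)‖_{p,w}`), `lpv_res_le` (`‖g∘e‖_{p,w} ≤ ‖g‖_{p,w}`) — an operator bound for a cube letter on the cube's own
  carrier is the same bound for the padded letter on the region.
* §2 THE TWO NORM FAMILIES ON ONE CARRIER: `abs_apply_le_siteNorm`, `norm_le_supN` (`‖Φ‖_∞ ≤ sup_x|φ(x)|`),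
  `sum_rpow_le_siteNorm_rpow` (`Σ_i|v_i|^q ≤ |v|^q`, `q ≥ 2`), `siteNorm_rpow_le` (`|v|^p ≤ N^{p/2}Σ_i|v_i|^p`,
  `p ≥ 1`... stated for `p > 0` with `1 ≤ p` where needed), `lpv_le_lpW` (`‖Φ‖^{entrywise}_{q,η} ≤ ‖Φ‖^{mixed}_{q,η}`,
  `q ≥ 2`, `w = vol⁻¹`), `lpW_le_sqrt_mul_lpv` (`‖Φ‖^{mixed}_{p,η} ≤ √N‖Φ‖^{entrywise}_{p,η}`, `p ≥ 1`).
* §3 TRANSFER OF OPERATOR BOUNDS: `lpv_bound_of_lpW_bound` (a mixed-norm bound `‖TΦ‖_{q,η} ≤ c‖Φ‖_{p,η}`,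
  `1 ≤ p`, `2 ≤ q`, gives `‖TΦ‖^{ew}_{q,η} ≤ √N·c·‖Φ‖^{ew}_{p,η}`), `norm_bound_of_supN_lpW_bound` (a bound
  `sup|TΦ| ≤ c‖Φ‖_{p,η}` gives `‖TΦ‖_∞ ≤ √N·c·‖Φ‖^{ew}_{p,η}`) — the forms of the hypotheses `hgr`, `h2` of
  `B4Ineq110LpChain.ineq110_value_lp` with `w = vol⁻¹ = η^{d+1}`.
HONEST SCOPE.  Finite-dimensional norm bookkeeping only; the colour factors `√N` are crude (power means would give
`N^{|1/2−1/p|}`) and harmless.  Theorems only; no `def`, no `Prop` fact, no `sorry`; axioms standard.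
-/

namespace Literature.MathematicalPhysics.QuantumFieldTheory.Balaban1983to89.B4LpNormTransfer

open Literature.MathematicalPhysics.QuantumFieldTheory.Balaban1983to89.B4GaugeCovariance (fld)
open Literature.MathematicalPhysics.QuantumFieldTheory.Balaban1983to89.B4Lemma21Region (siteNorm)
open Literature.MathematicalPhysics.QuantumFieldTheory.Balaban1983to89.B4Lemma22Reduce231 (supN le_supN supN_le
  supN_nonneg siteNorm_nonneg siteNorm_sq)
open Literature.MathematicalPhysics.QuantumFieldTheory.Balaban1983to89.B4Lemma22LpStair (lpS lpM lpM_nonneg lpS_nonneg)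
open Literature.MathematicalPhysics.QuantumFieldTheory.Balaban1983to89.B4Lemma22EtaBox (vol vol_pos lpW lpW_nonneg)
open Literature.MathematicalPhysics.QuantumFieldTheory.Balaban1983to89.B4CubeOpReindex (pad pad_apply_img
  pad_apply_of_left)
open Literature.MathematicalPhysics.QuantumFieldTheory.Balaban1983to89.B4Ineq110LpChain (lpv lpv_nonneg)
open scoped Matrix

noncomputable section

/-! ## §1. Vectors along an injection: padded operators act on restricted vectors -/

section Pad

variable {X X' κ : Type} [Fintype X] [Fintype X'] [Fintype κ] [DecidableEq X]

/-- a sum over `X` of a function vanishing off the range of an injection `e : X′ → X` is the sum over `X′`. [folklore] -/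
private theorem sum_range {M : Type*} [AddCommMonoid M] {e : X' → X} (he : Function.Injective e) (f : X → M)
    (hf : ∀ z, (∀ a, e a ≠ z) → f z = 0) : ∑ z, f z = ∑ a, f (e a) := by
  classical
  rw [← Finset.sum_image (f := f) (s := Finset.univ) (g := e) (fun a _ b _ h => he h)]
  symm
  apply Finset.sum_subset (Finset.subset_univ _)
  intro z _ hz
  apply hf
  intro a ha
  exact hz (Finset.mem_image.mpr ⟨a, Finset.mem_univ a, ha⟩)

/-- **ON THE IMAGE, `pad_e(B)g` IS `B(g∘e)`**: `(pad_e(B)g)(e a, i) = (B(g∘e))(a, i)` — the cube letter acts on the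
restriction of the field to the cube. [cite: Balaban1983RegularityDecay, (2.2) p.575, (2.13) p.577 (dictionary)] -/
theorem pad_mulVec_apply_img {e : X' → X} (he : Function.Injective e) (B : Matrix (X' × κ) (X' × κ) ℝ)
    (g : X × κ → ℝ) (a : X') (i : κ) :
    (pad e B *ᵥ g) (e a, i) = (B *ᵥ fun q : X' × κ => g (e q.1, q.2)) (a, i) := by
  simp only [Matrix.mulVec, dotProduct]
  rw [Fintype.sum_prod_type, Fintype.sum_prod_type,
    sum_range (M := ℝ) he (fun z => ∑ i', pad e B (e a, i) (z, i') * g (z, i'))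
      (fun z hz => Finset.sum_eq_zero fun i' _ => by
        rw [B4CubeOpReindex.pad_apply_of_right e B _ (p' := (z, i')) (fun b => hz b), zero_mul])]
  refine Finset.sum_congr rfl fun a' _ => Finset.sum_congr rfl fun i' _ => ?_
  rw [pad_apply_img he]

/-- **OFF THE IMAGE, `pad_e(B)g` VANISHES**. [cite: Balaban1983RegularityDecay, (2.2) p.575 (dictionary)] -/
theorem pad_mulVec_apply_off (e : X' → X) (B : Matrix (X' × κ) (X' × κ) ℝ) (g : X × κ → ℝ) {p : X × κ}
    (hp : ∀ a, e a ≠ p.1) : (pad e B *ᵥ g) p = 0 := by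
  simp only [Matrix.mulVec, dotProduct]
  exact Finset.sum_eq_zero fun p' _ => by rw [pad_apply_of_left e B hp, zero_mul]

/-- **THE SUP NORM OF `pad_e(B)g` IS THAT OF `B(g∘e)`**. [cite: Balaban1983RegularityDecay, (2.20) p.578 «‖·‖_∞» (dictionary)] -/
theorem norm_pad_mulVec {e : X' → X} (he : Function.Injective e) (B : Matrix (X' × κ) (X' × κ) ℝ)
    (g : X × κ → ℝ) : ‖pad e B *ᵥ g‖ = ‖B *ᵥ fun q : X' × κ => g (e q.1, q.2)‖ := by
  apply le_antisymm
  · refine (pi_norm_le_iff_of_nonneg (norm_nonneg _)).mpr fun p => ?_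
    by_cases hp : ∃ a, e a = p.1
    · obtain ⟨a, ha⟩ := hp
      obtain ⟨z, i⟩ := p
      simp only at ha
      subst ha
      rw [pad_mulVec_apply_img he]
      exact norm_le_pi_norm (B *ᵥ fun q : X' × κ => g (e q.1, q.2)) (a, i)
    · rw [pad_mulVec_apply_off e B g (fun a h => hp ⟨a, h⟩), norm_zero]
      exact norm_nonneg _
  · refine (pi_norm_le_iff_of_nonneg (norm_nonneg _)).mpr fun q => ?_
    obtain ⟨a, i⟩ := q
    rw [← pad_mulVec_apply_img he B g a i]
    exact norm_le_pi_norm (pad e B *ᵥ g) (e a, i)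

omit [DecidableEq X] in
/-- the restriction of a field to the cube has sup norm at most that of the field. [cite: Balaban1983RegularityDecay, (2.20) p.578 (dictionary)] -/
theorem norm_res_le (e : X' → X) (g : X × κ → ℝ) : ‖(fun q : X' × κ => g (e q.1, q.2))‖ ≤ ‖g‖ :=
  (pi_norm_le_iff_of_nonneg (norm_nonneg _)).mpr fun q => norm_le_pi_norm g (e q.1, q.2)

/-- **THE WEIGHTED `ℓ^p` NORM OF `pad_e(B)g` IS THAT OF `B(g∘e)`** (`p > 0`). [cite: Balaban1983RegularityDecay, (2.21) p.578 «‖·‖_{q,p}» (dictionary)] -/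
theorem lpv_pad_mulVec {e : X' → X} (he : Function.Injective e) {w p : ℝ} (hp : 0 < p)
    (B : Matrix (X' × κ) (X' × κ) ℝ) (g : X × κ → ℝ) :
    lpv w p (pad e B *ᵥ g) = lpv w p (B *ᵥ fun q : X' × κ => g (e q.1, q.2)) := by
  unfold lpv
  congr 2
  rw [Fintype.sum_prod_type, Fintype.sum_prod_type,
    sum_range (M := ℝ) he (fun z => ∑ i, |(pad e B *ᵥ g) (z, i)| ^ p)
      (fun z hz => Finset.sum_eq_zero fun i _ => by
        rw [pad_mulVec_apply_off e B g (p := (z, i)) hz, abs_zero, Real.zero_rpow hp.ne'])]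
  refine Finset.sum_congr rfl fun a _ => Finset.sum_congr rfl fun i _ => ?_
  rw [pad_mulVec_apply_img he]

/-- the restriction of a field to the cube has weighted `ℓ^p` norm at most that of the field (`w ≥ 0`, `p > 0`).
[cite: Balaban1983RegularityDecay, (2.21) p.578 (dictionary)] -/
theorem lpv_res_le {e : X' → X} (he : Function.Injective e) {w p : ℝ} (hw : 0 ≤ w) (hp : 0 < p) (g : X × κ → ℝ) :
    lpv w p (fun q : X' × κ => g (e q.1, q.2)) ≤ lpv w p g := by
  classical
  unfold lpv
  refine Real.rpow_le_rpow (mul_nonneg hw (Finset.sum_nonneg fun _ _ => Real.rpow_nonneg (abs_nonneg _) _))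
    (mul_le_mul_of_nonneg_left ?_ hw) (by positivity)
  rw [Fintype.sum_prod_type, Fintype.sum_prod_type]
  have himg : ∑ a, ∑ i, |g (e a, i)| ^ p = ∑ z ∈ Finset.univ.image e, ∑ i, |g (z, i)| ^ p := by
    rw [Finset.sum_image (fun a _ b _ h => he h)]
  rw [himg]
  exact Finset.sum_le_sum_of_subset_of_nonneg (Finset.subset_univ _)
    (fun z _ _ => Finset.sum_nonneg fun i _ => Real.rpow_nonneg (abs_nonneg _) _)

end Pad

/-! ## §2. Entrywise versus mixed norms on one carrier -/

section Mixed

variable {X : Type*} [Fintype X] {ι : Type} [Fintype ι]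

/-- a component is at most the Euclidean colour norm: `|v_i| ≤ |v|`. [folklore] -/
private theorem abs_apply_le_siteNorm (v : ι → ℝ) (i : ι) : |v i| ≤ siteNorm v := by
  unfold siteNorm
  apply Real.abs_le_sqrt
  rw [dotProduct]
  calc v i ^ 2 = v i * v i := sq (v i)
    _ ≤ ∑ j, v j * v j := Finset.single_le_sum (f := fun j => v j * v j) (fun j _ => mul_self_nonneg (v j))
        (Finset.mem_univ i)

/-- **`‖Φ‖_∞ ≤ sup_x |φ(x)|`**: Mathlib's sup norm over sites and colours is at most the lineage's `supN`.
[cite: Balaban1983RegularityDecay, (2.20) p.578 «‖·‖_∞» (dictionary)] -/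
theorem norm_le_supN (Φ : X × ι → ℝ) : ‖Φ‖ ≤ supN Φ :=
  (pi_norm_le_iff_of_nonneg (supN_nonneg Φ)).mpr fun p => by
    rw [Real.norm_eq_abs]
    exact (abs_apply_le_siteNorm (fld Φ p.1) p.2).trans (le_supN Φ p.1)

/-- **`Σ_i |v_i|^q ≤ |v|^q` for `q ≥ 2`** (the entrywise `ℓ^q` norm of a colour vector is at most its Euclidean norm).
[folklore] -/
private theorem sum_rpow_le_siteNorm_rpow {q : ℝ} (hq : 2 ≤ q) (v : ι → ℝ) : ∑ i, |v i| ^ q ≤ siteNorm v ^ q := by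
  have hs0 : 0 ≤ siteNorm v := siteNorm_nonneg v
  have hle : ∀ i, |v i| ≤ siteNorm v := abs_apply_le_siteNorm v
  have hq0 : q ≠ 0 := by linarith
  -- `|v_i|^q = |v_i|²·|v_i|^{q−2} ≤ v_i²·|v|^{q−2}`
  have hterm : ∀ i, |v i| ^ q ≤ v i ^ 2 * siteNorm v ^ (q - 2) := fun i => by
    have hsplit : |v i| ^ q = |v i| ^ (2 : ℝ) * |v i| ^ (q - 2) := by
      rw [← Real.rpow_add' (abs_nonneg _) (by rw [show (2 : ℝ) + (q - 2) = q by ring]; exact hq0)]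
      ring_nf
    rw [hsplit, Real.rpow_two, sq_abs]
    exact mul_le_mul_of_nonneg_left (Real.rpow_le_rpow (abs_nonneg _) (hle i) (by linarith)) (sq_nonneg _)
  calc ∑ i, |v i| ^ q ≤ ∑ i, v i ^ 2 * siteNorm v ^ (q - 2) := Finset.sum_le_sum fun i _ => hterm i
    _ = (∑ i, v i ^ 2) * siteNorm v ^ (q - 2) := by rw [Finset.sum_mul]
    _ = siteNorm v ^ (2 : ℝ) * siteNorm v ^ (q - 2) := by
        rw [Real.rpow_two, siteNorm_sq, dotProduct]
        congr 1
        exact Finset.sum_congr rfl fun i _ => (sq (v i)).trans rfl |>.symm ▸ (sq (v i))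
    _ = siteNorm v ^ q := by
        rw [← Real.rpow_add' hs0 (by rw [show (2 : ℝ) + (q - 2) = q by ring]; exact hq0)]
        ring_nf

/-- **`|v|^p ≤ N^{p/2}·Σ_i |v_i|^p` for `p > 0`** (`N = card ι`): the Euclidean colour norm against the entrywise `ℓ^p`
norm, crude constant. [folklore] -/
private theorem siteNorm_rpow_le {p : ℝ} (hp : 0 < p) (v : ι → ℝ) :
    siteNorm v ^ p ≤ ((Fintype.card ι : ℝ)) ^ (p / 2) * ∑ i, |v i| ^ p := by
  set T : ℝ := ∑ i, |v i| ^ p with hT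
  have hT0 : 0 ≤ T := Finset.sum_nonneg fun i _ => Real.rpow_nonneg (abs_nonneg _) _
  have hs0 : 0 ≤ siteNorm v := siteNorm_nonneg v
  -- each `v_i² = (|v_i|^p)^{2/p} ≤ T^{2/p}`
  have hsq : ∀ i, v i ^ 2 ≤ T ^ (2 / p) := fun i => by
    have h1 : |v i| ^ p ≤ T :=
      Finset.single_le_sum (f := fun j => |v j| ^ p) (fun j _ => Real.rpow_nonneg (abs_nonneg _) _)
        (Finset.mem_univ i)
    have h2 : (|v i| ^ p) ^ (2 / p) ≤ T ^ (2 / p) :=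
      Real.rpow_le_rpow (Real.rpow_nonneg (abs_nonneg _) _) h1 (by positivity)
    rw [← Real.rpow_mul (abs_nonneg _), show p * (2 / p) = 2 by field_simp, Real.rpow_two, sq_abs] at h2
    exact h2
  -- so `|v|² ≤ N·T^{2/p}` and `|v| ≤ √N·T^{1/p}`
  have hsq' : siteNorm v ^ 2 ≤ (Fintype.card ι : ℝ) * T ^ (2 / p) := by
    rw [siteNorm_sq, dotProduct]
    calc ∑ i, v i * v i = ∑ i, v i ^ 2 := Finset.sum_congr rfl fun i _ => (sq (v i)).symm
      _ ≤ ∑ _i : ι, T ^ (2 / p) := Finset.sum_le_sum fun i _ => hsq i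
      _ = (Fintype.card ι : ℝ) * T ^ (2 / p) := by rw [Finset.sum_const, nsmul_eq_mul, Finset.card_univ]
  have hN0 : (0 : ℝ) ≤ Fintype.card ι := Nat.cast_nonneg _
  have hs1 : siteNorm v ≤ Real.sqrt (Fintype.card ι) * T ^ (1 / p) := by
    have h3 : siteNorm v ^ 2 ≤ (Real.sqrt (Fintype.card ι) * T ^ (1 / p)) ^ 2 := by
      rw [mul_pow, Real.sq_sqrt hN0, ← Real.rpow_natCast (T ^ (1 / p)) 2, ← Real.rpow_mul hT0]
      have h22 : (1 : ℝ) / p * ((2 : ℕ) : ℝ) = 2 / p := by push_cast; ring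
      rw [h22]
      exact hsq'
    nlinarith [hs0, Real.sqrt_nonneg (Fintype.card ι : ℝ), Real.rpow_nonneg hT0 (1 / p),
      mul_nonneg (Real.sqrt_nonneg (Fintype.card ι : ℝ)) (Real.rpow_nonneg hT0 (1 / p))]
  -- raise to the power `p`
  have h4 := Real.rpow_le_rpow hs0 hs1 hp.le
  rw [Real.mul_rpow (Real.sqrt_nonneg _) (Real.rpow_nonneg hT0 _), ← Real.rpow_mul hT0,
    show (1 : ℝ) / p * p = 1 by field_simp, Real.rpow_one, Real.sqrt_eq_rpow, ← Real.rpow_mul hN0,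
    show (1 : ℝ) / 2 * p = p / 2 by ring] at h4
  exact h4

/-- **ENTRYWISE `≤` MIXED** for `q ≥ 2` in the `η`-weighted normalisation (`w = vol⁻¹ = η^{d+1}`):
`‖Φ‖^{ew}_{q,η} ≤ ‖Φ‖^{mixed}_{q,η}` (`B4Ineq110LpChain.lpv` against `B4Lemma22EtaBox.lpW`).
[cite: Balaban1983RegularityDecay, (2.21) p.578 «‖·‖_{q,p}», (2.17) p.578 «the usual L_q and L_p norms» (dictionary)] -/
theorem lpv_le_lpW (d ℓ k : ℕ) {q : ℝ} (hq : 2 ≤ q) (Φ : X × ι → ℝ) :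
    lpv (vol d ℓ k)⁻¹ q Φ ≤ lpW d ℓ k q Φ := by
  have hV := vol_pos d ℓ k
  have hw : 0 ≤ (vol d ℓ k)⁻¹ := inv_nonneg.2 hV.le
  have hq0 : 0 < q := by linarith
  have hsum : ∑ p : X × ι, |Φ p| ^ q ≤ ∑ x, |siteNorm (fld Φ x)| ^ q := by
    rw [Fintype.sum_prod_type]
    refine Finset.sum_le_sum fun x _ => ?_
    rw [abs_of_nonneg (siteNorm_nonneg _)]
    exact sum_rpow_le_siteNorm_rpow hq (fld Φ x)
  have hS0 : 0 ≤ ∑ p : X × ι, |Φ p| ^ q := Finset.sum_nonneg fun _ _ => Real.rpow_nonneg (abs_nonneg _) _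
  unfold lpv lpW lpM lpS
  rw [Real.mul_rpow hw hS0, show (1 : ℝ) / q = q⁻¹ from one_div q]
  exact mul_le_mul_of_nonneg_left (Real.rpow_le_rpow hS0 hsum (inv_nonneg.2 hq0.le)) (Real.rpow_nonneg hw _)

/-- **MIXED `≤ √N·`ENTRYWISE** for `p > 0` in the `η`-weighted normalisation: `‖Φ‖^{mixed}_{p,η} ≤ √N‖Φ‖^{ew}_{p,η}`.
[cite: Balaban1983RegularityDecay, (2.21) p.578 «‖·‖_{q,p}» (dictionary)] -/
theorem lpW_le_sqrt_mul_lpv (d ℓ k : ℕ) {p : ℝ} (hp : 0 < p) (Φ : X × ι → ℝ) :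
    lpW d ℓ k p Φ ≤ Real.sqrt (Fintype.card ι) * lpv (vol d ℓ k)⁻¹ p Φ := by
  have hV := vol_pos d ℓ k
  have hw : 0 ≤ (vol d ℓ k)⁻¹ := inv_nonneg.2 hV.le
  have hN0 : (0 : ℝ) ≤ Fintype.card ι := Nat.cast_nonneg _
  have hS0 : 0 ≤ ∑ q : X × ι, |Φ q| ^ p := Finset.sum_nonneg fun _ _ => Real.rpow_nonneg (abs_nonneg _) _
  -- `Σ_x |φ(x)|^p ≤ N^{p/2} Σ_{x,i} |Φ(x,i)|^p`
  have hsum : ∑ x, |siteNorm (fld Φ x)| ^ p ≤ (Fintype.card ι : ℝ) ^ (p / 2) * ∑ q : X × ι, |Φ q| ^ p := by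
    rw [Fintype.sum_prod_type, Finset.mul_sum]
    refine Finset.sum_le_sum fun x _ => ?_
    rw [abs_of_nonneg (siteNorm_nonneg _)]
    exact siteNorm_rpow_le hp (fld Φ x)
  have hM0 : 0 ≤ ∑ x, |siteNorm (fld Φ x)| ^ p := Finset.sum_nonneg fun _ _ => Real.rpow_nonneg (abs_nonneg _) _
  unfold lpv lpW lpM lpS
  rw [Real.mul_rpow hw hS0, show (1 : ℝ) / p = p⁻¹ from one_div p]
  -- `(Σ_x |φ(x)|^p)^{1/p} ≤ √N·(ΣΣ)^{1/p}`
  have h1 : (∑ x, |siteNorm (fld Φ x)| ^ p) ^ p⁻¹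
      ≤ Real.sqrt (Fintype.card ι) * (∑ q : X × ι, |Φ q| ^ p) ^ p⁻¹ := by
    have h2 := Real.rpow_le_rpow hM0 hsum (inv_nonneg.2 hp.le)
    rw [Real.mul_rpow (Real.rpow_nonneg hN0 _) hS0, ← Real.rpow_mul hN0,
      show p / 2 * p⁻¹ = 1 / 2 by field_simp, ← Real.sqrt_eq_rpow] at h2
    exact h2
  calc (vol d ℓ k)⁻¹ ^ p⁻¹ * (∑ x, |siteNorm (fld Φ x)| ^ p) ^ p⁻¹
      ≤ (vol d ℓ k)⁻¹ ^ p⁻¹ * (Real.sqrt (Fintype.card ι) * (∑ q : X × ι, |Φ q| ^ p) ^ p⁻¹) :=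
        mul_le_mul_of_nonneg_left h1 (Real.rpow_nonneg hw _)
    _ = Real.sqrt (Fintype.card ι) * ((vol d ℓ k)⁻¹ ^ p⁻¹ * (∑ q : X × ι, |Φ q| ^ p) ^ p⁻¹) := by ring

end Mixed

/-! ## §3. Transfer of operator bounds into the norms of the general-`Ω` chain -/

section Transfer

variable {X : Type*} [Fintype X] {Y : Type*} [Fintype Y] {ι : Type} [Fintype ι]

/-- **A MIXED-NORM FACTOR BOUND IS AN ENTRYWISE FACTOR BOUND** (`1 ≤ p`, `2 ≤ q`, `w = η^{d+1}`): from
`‖Ψ‖^{mixed}_{q,η} ≤ c‖Φ‖^{mixed}_{p,η}` (the Lemma-2.2 lineage's (2.21)) to `‖Ψ‖^{ew}_{q,η} ≤ √N·c·‖Φ‖^{ew}_{p,η}` (the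
hypotheses `hgr` (`t ≥ 2`) and `h2` of `B4Ineq110LpChain.ineq110_value_lp`).
[cite: Balaban1983RegularityDecay, (2.21) p.578 «‖K_{ω_i}G_k(□_{ω_i},Ã_{ω_i})h_{ω_i}‖_{p₁/(i−1),p₁/i}», «‖·‖_{2,2}»] -/
theorem lpv_bound_of_lpW_bound (d ℓ k : ℕ) {p q c : ℝ} (hp : 0 < p) (hq : 2 ≤ q) (hc : 0 ≤ c) {Φ : X × ι → ℝ}
    {Ψ : Y × ι → ℝ} (h : lpW d ℓ k q Ψ ≤ c * lpW d ℓ k p Φ) :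
    lpv (vol d ℓ k)⁻¹ q Ψ ≤ Real.sqrt (Fintype.card ι) * c * lpv (vol d ℓ k)⁻¹ p Φ := by
  have h1 := lpv_le_lpW (X := Y) d ℓ k hq Ψ
  have h2 := lpW_le_sqrt_mul_lpv (X := X) d ℓ k hp Φ
  have hN : 0 ≤ Real.sqrt (Fintype.card ι : ℝ) := Real.sqrt_nonneg _
  calc lpv (vol d ℓ k)⁻¹ q Ψ ≤ lpW d ℓ k q Ψ := h1
    _ ≤ c * lpW d ℓ k p Φ := h
    _ ≤ c * (Real.sqrt (Fintype.card ι) * lpv (vol d ℓ k)⁻¹ p Φ) := mul_le_mul_of_nonneg_left h2 hc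
    _ = Real.sqrt (Fintype.card ι) * c * lpv (vol d ℓ k)⁻¹ p Φ := by ring

/-- **A SUP/MIXED FACTOR BOUND IS A SUP/ENTRYWISE FACTOR BOUND** (`p > 0`): from `sup_x|ψ(x)| ≤ c‖Φ‖^{mixed}_{p,η}`
(the lineage's factor `‖·‖_{∞,p₁}`) to `‖Ψ‖_∞ ≤ √N·c·‖Φ‖^{ew}_{p,η}` (the hypothesis `hgr` at `t = 1` of
`B4Ineq110LpChain.ineq110_value_lp`). [cite: Balaban1983RegularityDecay, (2.21) p.578 «‖K_{ω₁}G_k(□_{ω₁},Ã_{ω₁})h_{ω₁}‖_{∞,p₁}»] -/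
theorem norm_bound_of_supN_lpW_bound (d ℓ k : ℕ) {p c : ℝ} (hp : 0 < p) (hc : 0 ≤ c) {Φ : X × ι → ℝ}
    {Ψ : Y × ι → ℝ} (h : supN Ψ ≤ c * lpW d ℓ k p Φ) :
    ‖Ψ‖ ≤ Real.sqrt (Fintype.card ι) * c * lpv (vol d ℓ k)⁻¹ p Φ := by
  have h2 := lpW_le_sqrt_mul_lpv (X := X) d ℓ k hp Φ
  calc ‖Ψ‖ ≤ supN Ψ := norm_le_supN Ψ
    _ ≤ c * lpW d ℓ k p Φ := h
    _ ≤ c * (Real.sqrt (Fintype.card ι) * lpv (vol d ℓ k)⁻¹ p Φ) := mul_le_mul_of_nonneg_left h2 hc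
    _ = Real.sqrt (Fintype.card ι) * c * lpv (vol d ℓ k)⁻¹ p Φ := by ring

/-- **A SUP FACTOR BOUND IN `supN` IS A SUP FACTOR BOUND IN `‖·‖_∞`, VECTOR FORM**: from `sup_x|ψ(x)| ≤ c·sup_x|φ(x)|` to
`‖Ψ‖_∞ ≤ √N·c·‖Φ‖_∞` (companion of `B4CubeOpReindex.linfty_opNorm_le_of_supN`, which is the operator-norm form).
[cite: Balaban1983RegularityDecay, (2.20) p.578 «‖·‖_∞»] -/
theorem norm_bound_of_supN_bound {c : ℝ} (hc : 0 ≤ c) {Φ : X × ι → ℝ} {Ψ : Y × ι → ℝ}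
    (h : supN Ψ ≤ c * supN Φ) : ‖Ψ‖ ≤ Real.sqrt (Fintype.card ι) * c * ‖Φ‖ := by
  have hN : 0 ≤ Real.sqrt (Fintype.card ι : ℝ) := Real.sqrt_nonneg _
  -- `supN Φ ≤ √N‖Φ‖`
  have hΦ : supN Φ ≤ Real.sqrt (Fintype.card ι) * ‖Φ‖ := by
    refine supN_le (by positivity) fun x => ?_
    have hsq : siteNorm (fld Φ x) ^ 2 ≤ (Real.sqrt (Fintype.card ι) * ‖Φ‖) ^ 2 := by
      rw [siteNorm_sq, dotProduct, mul_pow, Real.sq_sqrt (Nat.cast_nonneg _)]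
      calc ∑ i, fld Φ x i * fld Φ x i ≤ ∑ _i : ι, ‖Φ‖ ^ 2 := Finset.sum_le_sum fun i _ => by
              have h1 : |fld Φ x i| ≤ ‖Φ‖ := by
                have := norm_le_pi_norm Φ (x, i)
                rwa [Real.norm_eq_abs] at this
              rw [← sq, ← sq_abs]
              exact pow_le_pow_left₀ (abs_nonneg _) h1 2
        _ = (Fintype.card ι : ℝ) * ‖Φ‖ ^ 2 := by rw [Finset.sum_const, nsmul_eq_mul, Finset.card_univ]
    nlinarith [siteNorm_nonneg (fld Φ x), norm_nonneg Φ, mul_nonneg hN (norm_nonneg Φ)]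
  calc ‖Ψ‖ ≤ supN Ψ := norm_le_supN Ψ
    _ ≤ c * supN Φ := h
    _ ≤ c * (Real.sqrt (Fintype.card ι) * ‖Φ‖) := mul_le_mul_of_nonneg_left hΦ hc
    _ = Real.sqrt (Fintype.card ι) * c * ‖Φ‖ := by ring

end Transfer

end

end Literature.MathematicalPhysics.QuantumFieldTheory.Balaban1983to89.B4LpNormTransfer
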